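import Summits.QuantumFields.BalabanUV.T4Continuum.Spine.NE1p.DressedSmallFieldRecordLabels
import Summits.QuantumFields.BalabanUV.T4Continuum.Spine.NE1p.DressedSmallFieldInnerLink
import Summits.QuantumFields.BalabanUV.T4Continuum.Support.TorusBlockRefinement

/-!
# T⁴ programme, spine estimate NE1′ (node O3b/H2) — THE OWNER's N0y (THE SECOND-STEP COUNT AND THE CORES' ENDs AT ROW NE5's LABEL
# TYPE OF RECORD `InnerLabel ⟨Z₀, fam, P⟩`) ON pv22's TORUS `tsys 4 N` AND ON THE NESTED TORI `(N, L·N)`: the footprint map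
# `foot := trefineDom L N` with `hmono` (S43.1) AND the (2.27)-link `hlink` (S40.1 `link_torus`, `c₃₂ = 5`) SUPPLIED BY NAME, the
# (2.29)∕step clauses LOCATED at both scales — NO footprint map, NO `hmono`, NO link binder, NO `Geometry` hypothesis remain

Cell `pub-balaban`, sub-cell `t4`, BINDER-OWNERS row NE1′ (owner lineage t4-ne1p-p1, road P1 «RG-trajectory comparison … μ-uniformity
through the printed small-field bounds»); crew seat `b2b-balaban-t4-ne1p-formalise-leaf-05` (LEAF PROVER 05, generation 12); crew S-row
(INTENT `CLAIMS.log` 2026-08-20, typer `b2b-balaban-t4-ne1p-formalise-typer` gen 7).  ADDITIVE — imports the owner's N0y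
`Spine/NE1p/DressedSmallFieldRecordLabels` (p237039; → N0x → N0w → … → N0s; row NE5's `Support/B13StepTermLabels` in its cone), crew
row S40 PART 1 `Spine/NE1p/DressedSmallFieldInnerLink` (`link_torus`; → N0u, S24 `K₀_four`, N0o `torus_consts`) and crew row S43 PART 1
`Support/TorusBlockRefinement` (`trefineDom`, `torusTreeLen_le_trefine`) ONLY; THEOREMS ONLY (0 `def`, 0 `def … : Prop`, 0 cite);
nothing of N0y ∕ N0x ∕ N0s ∕ S40 ∕ S43 ∕ S24 ∕ N0o ∕ row NE5 ∕ pv22 is restated — their declarations are used BY NAME.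

WHY THIS FILE (typer R-T102 (i): every owner END with a `Geometry` socket gets its torus form; the lineage's S34 ∕ S39 ∕ S43.2 ∕ S48
pattern).  N0y is the (B1b)-INDEXING half of the owner's small-field chain: N0x's table-free second-step count and N0s §3's count ENDs
RE-INDEXED by row NE5's label TYPE of record `B13StepTermLabels.InnerLabel Dk.Dom Bnd = ⟨Z₀, fam, P⟩` (the conditioning domain, the
Mayer subfamily, the bond set), over TWO abstract geometries `G : Geometry D Cube` (scale k+1) and `Gk : Geometry Dk CubeK` (scale k)
with the footprint map `foot : D.Dom → Dk.Dom`, `hmono`, and the (2.27)∘(2.32)-KIND link `hlink` DISPLAYED.  Row NE5 and the substrate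
read Bałaban's carrier AS pv22's periodic torus (`Support/SubstrateFrameOfRecord`, `tgeometry 4 N`); this file puts N0y there:
* §1 ONE TORUS (`D = Dk := tsys 4 N`, `G = Gk := tgeometry 4 N`, `foot := id`, `hmono := le_rfl`): **`count_recordLabels_torus`**,
  **`attachedPart_locE_le_of_coresAt_pencil_recordLabels_torus`**, **`muPart_locE_le_of_coresAt_pencil_recordLabels_torus`** — N0y §1 ∕ §2
  ONCE EACH BY NAME with `hlink := link_torus 4 N` (S40.1 §2: (2.27) on the family augmented by the uncovered unit cubes, `c₃₂ = 5`,
  NO hypothesis) and pv22's located letters by N0o `torus_consts` ∕ S24 `K₀_four` (`ν = 9`, `κ₀ = 64·log 162`, `c₁ = 64`,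
  `K₀ = K₀(64,8)`; `b₅ := 5·r₁`).
* §2 NESTED TORI (`D := tsys 4 N` = scale k+1, `Dk := tsys 4 (L·N)` = scale k, `G := tgeometry 4 N`, `Gk := tgeometry 4 (L·N)`,
  `foot := trefineDom L N`, `hmono := torusTreeLen_le_trefine` — S43.1, [Dimock2013] §3 Lemma 10 BY NAME through pv22's
  `mul_torusTreeLen_image_le`): **`count_recordLabels_refined`**, **`attachedPart_locE_le_of_coresAt_pencil_recordLabels_refined`**,
  **`muPart_locE_le_of_coresAt_pencil_recordLabels_refined`** — N0y §1 ∕ §2 ONCE EACH BY NAME with `hlink := link_torus 4 (L·N)` at the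
  refined footprint and the letters located at BOTH scales (the same numerals at `N` and at `L·N` — `N`- and `L`-uniform).
In the resulting statements a record label `ℓ = ⟨Z₀, fam, P⟩` of a polymer `Z` of the COARSE torus is conditioned at the refined
footprint `ℓ.Z₀ = trefineDom L N Z` (the `L⁴·#Z` fine cubes of the blocks of `Z`), its family `fam` consists of localization domains of
the FINE torus inside that footprint, its bonds satisfy print's finer constraints `P ⊆ bondsOf (Z₀ ∖ ∪fam)`, `#(Z₀ ∖ ∪fam) ≤ 2·#P`
(`hadm`, INLINE as in N0y — no `Prop` minted); NO footprint map, NO `hmono`, NO link binder, NO geometry hypothesis remain.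
WHAT STAYS DISPLAYED (binders, BY NAME; nothing instantiated on Bałaban's densities): the operator letters `hm`∕`hN`∕`hq`, room, class
radii, (B1b)'s residue `emb`∕`hscale`∕`hact`∕`terms` and `hadm` (the terms of `Z` ARE NE5-labels conditioned at its (refined) footprint,
admissible in print's sense — READING; the identification of the scale-`k` catalogue with the carriers' inner level and the «zero
terms off the filter» convention stay the substrate's to name, Q-NE1p-emb); (B3-amp) `hAmp` — THE place where the dressed table radius
enters, p. 18's clause KIND at `C₃(E₀ + D₀)`, NOT asserted; the bond letter `bondsOf`∕`hb₀` (bonds per cube `b₀`); `hs0`∕`hs1`∕`ht`;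
the located clauses `64·log 162 + 1 ≤ δκ`, `e·K₀(64,8)·64·α₆ ≤ 1`, `r₁ + 2·(64·log 162) + 2 ≤ Rkp ≤ R − 64·(e^{5R}·s·e^{b₀t})`,
`(A₀ + ϱA₁)·e^{5r₁+1}·K₀(64,8)·9·64 ≤ 1` ((B5): SHAPES consumed BY NAME — these ARE pv22's cite-tagged `ineq229_torus_unit 4 _`
letters (S34.2 (E′)); their standing against print's NUMBERS is NOT asserted); N0m's `hϱ`∕`hϱA`; the μ-window `0 < μ₀ < μ₁`.
WHICH pair `(N, L·N)` of nested tori is Bałaban's `(𝐃_{k+1}, 𝐃_k)` and `L` his scaling integer stay pv22's READING (DIVERGENCE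
D-pv22.3), not asserted; print's (2.32) constant `4` vs the typed `5` = S40's record (GAPS G-B13-08), TYPE∕CONTEXT.

PRINTED LOCI (TYPE ∕ CONTEXT only — [Balaban1988RGII] = CMP 116 (1988): p. 12 (2.1)–(2.4) (the labels `𝐃 ⊂ 𝐃_k`, `Y₀`, `P ⊂ Y₀^{c*}`,
`Z₀`), p. 15 (2.14) (the term carries the label `(Z₀, 𝐃, P)`), p. 17 «For a fixed Y₀ we sum over all 𝐃 satisfying (2.2). Next, we sum
over Y₀, P determining a fixed Z₀», p. 18 «|P| ≥ ½M⁻⁴|Z₀∖Y₀|», (2.27)–(2.34) pp. 17–19; [Balaban1987RGI] = CMP 109 (1987) p. 251 (ONE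
torus; π_{k+1}-cubes = blocks of L⁴ cubes of π_k); [Dimock2013] §3 Lemma 10 (`L·d_{LM}(X̄′) ≤ d_M(X̄)`) — all quoted in the imported
modules' headers (N0y, N0x, N0u, S40.1, S43.1, pv22's cite-tagged `TreeLengthTorus*`), re-asserted nowhere here.

HONEST FRAMING (c3∕c4∕c6∕k1–k3).  Kernel bookkeeping: six by-name applications of the owner's N0y over hypothesis SHAPES, with two
landed crew constructions (S40.1's link, S43.1's refinement) plugged in; the cores ∕ record labels are the cell's typed FORMAT of (2.14)
and of print's second resummation step at row NE5's index TYPE, NOT Bałaban's functions; 0 binders instantiated on Bałaban's (2.14)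
data; no new inequality; (B1b) ∕ (B3-amp) ∕ (B3-form) ∕ (B5) for Bałaban's objects NOT discharged; no wall item moves; the NE1′ wall
wording of record v1.8 (T4-DAG v48) — words, not kind — does NOT move; R-t4r2-Q2 NOT met thereby.  ABSOLUTE RULE honoured: printed loci
are TYPE∕CONTEXT through the imported cite-tagged Literature modules only; nothing internally minted is cited; [folklore] tags on kernel
lemmas only; no placeholders.  NE1′ ⇐ the named binders — NOT printed, NOT proved; spine PROVED 0∕9; count 9 unchanged.  Rung (B)+1 on
ONE finite four-torus — NOT infinite volume, NOT a mass gap, NOT OS on ℝ⁴, NOT Clay.  HONEST DEPENDENCY: continuum YM on T⁴ ⇐ BetaPertH ∧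
nine spine estimates (0/9 proved); BetaPertH ⇐ (D1) ∧ (D4) ∧ CAP+tail; G-an2-4 gates asym, D1 and NE2/3/4.
-/
noncomputable section

namespace Summit.QuantumFields.BalabanUV.T4Continuum.NE1p.DressedSmallFieldRecordLabelsTorus

open Metric Set Complex MeasureTheory
open scoped BigOperators
open Literature.MathematicalPhysics.QuantumFieldTheory.Balaban1983to89.T4OutputRate (Carriers)
open Literature.MathematicalPhysics.QuantumFieldTheory.Balaban1983to89.B13Resummation (locE)
open Literature.MathematicalPhysics.QuantumFieldTheory.Balaban1983to89.B13FamilySum (coveringFamilies)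
open Literature.MathematicalPhysics.QuantumFieldTheory.Balaban1983to89.TreeLengthTorus (TPt TDom tsys torusTreeLen)
open Literature.MathematicalPhysics.QuantumFieldTheory.Balaban1983to89.TreeLengthTorusGeometry (TTouch tgeometry)
open Literature.MathematicalPhysics.QuantumFieldTheory.Balaban1983to89.B12TreeDecay (K₀)
open Summit.QuantumFields.BalabanUV.T4Continuum.B13HistMeasurable (MeasPotFrame B13HistM)
open Summit.QuantumFields.BalabanUV.T4Continuum.B13TermParamGaussianBi (BiCore)
open Summit.QuantumFields.BalabanUV.T4Continuum.B13StepTermLabels (InnerLabel)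
open Summit.QuantumFields.BalabanUV.T4Continuum.TorusBlockRefinement (trefineDom torusTreeLen_le_trefine)
open Summit.QuantumFields.BalabanUV.T4Continuum.NE1p.DressedSmallFieldInnerLink (link_torus)
open Summit.QuantumFields.BalabanUV.T4Continuum.NE1p.DressedSmallFieldGeometry (torus_consts)
open Summit.QuantumFields.BalabanUV.T4Continuum.NE1p.DressedSmallFieldGeometryFaces (K₀_four)
open Summit.QuantumFields.BalabanUV.T4Continuum.NE1p.DressedSmallFieldRecordLabels (count_recordLabels_geometry
  attachedPart_locE_le_of_coresAt_pencil_recordLabels muPart_locE_le_of_coresAt_pencil_recordLabels)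

/-! ## §1 ON ONE TORUS `tsys 4 N` (`foot := id`): the count and the two ENDs, link supplied, letters located -/

section OneTorus

variable {N : ℕ} [NeZero N] {Bnd : Type} [DecidableEq Bnd]

open Classical in
/-- **N0y's SECOND-STEP COUNT OVER NE5's LABELS ON THE TORUS — NO LINK BINDER, NO GEOMETRY HYPOTHESIS** (kernel; N0y §1
`count_recordLabels_geometry` ONCE BY NAME at `D = Dk := tsys 4 N`, `Gk := tgeometry 4 N`, `foot := id`, `hmono := le_rfl`,
`hlink := link_torus 4 N` (`c₃₂ = 5`), `κ₀ = 64·log 162`, `c₁ = 64`, `K₀ = K₀(64,8)` located by `torus_consts` ∕ `K₀_four`): for record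
labels `⟨Z₀, fam, P⟩` of a torus polymer `Z` with `Z₀ = Z`, `fam` inside `Z₀`, `P ⊆ bondsOf (Z₀ ∖ ∪fam)`, `#(Z₀ ∖ ∪fam) ≤ 2·#P` (`hadm`)
and the displayed letters: `Σ_{ℓ ∈ terms Z} (Π_{Y∈ℓ.fam} α₆e^{−δκ·d Y}e^{−R(d Y+5)})·(s²t)^{#ℓ.P} ≤ e^{−Rkp·torusTreeLen Z}`. [folklore] -/
theorem count_recordLabels_torus (bondsOf : Finset (TPt 4 N) → Finset Bnd) {δ κ α₆ R Rkp b₀ s t : ℝ} (hα₆ : 0 ≤ α₆)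
    (hκ : 64 * Real.log 162 + 1 ≤ δ * κ) (h229 : Real.exp 1 * K₀ 64 8 * 64 * α₆ ≤ 1) (hs0 : 0 ≤ s) (hs1 : s ≤ 1)
    (ht : 0 ≤ t) (hb₀ : ∀ W, ((bondsOf W).card : ℝ) ≤ b₀ * W.card) (hRkp : 0 ≤ Rkp)
    (hRR : Rkp ≤ R - 64 * (Real.exp (R * 5) * s * Real.exp (b₀ * t)))
    {terms : (tsys 4 N).Dom → Finset (InnerLabel (TDom 4 N) Bnd)}
    (hadm : ∀ Z : (tsys 4 N).Dom, ∀ ℓ ∈ terms Z, ℓ.Z₀ = Z ∧ (∀ Y ∈ ℓ.fam, Y.1 ⊆ ℓ.Z₀.1) ∧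
      ℓ.P ⊆ bondsOf (ℓ.Z₀.1 \ ℓ.fam.biUnion fun Y : (tsys 4 N).Dom => Y.1) ∧
        (ℓ.Z₀.1 \ ℓ.fam.biUnion fun Y : (tsys 4 N).Dom => Y.1).card ≤ 2 * ℓ.P.card)
    (Z : (tsys 4 N).Dom) :
    ∑ ℓ ∈ terms Z, (∏ Y ∈ ℓ.fam, (α₆ * Real.exp (-(δ * κ * torusTreeLen Y.1)) *
        Real.exp (-(R * (torusTreeLen Y.1 + 5))))) * (s ^ 2 * t) ^ ℓ.P.card ≤ Real.exp (-(Rkp * torusTreeLen Z.1)) := by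
  obtain ⟨-, hκ₀, hc⟩ := torus_consts N
  have hK₀ := K₀_four (N := N)
  exact count_recordLabels_geometry (D := tsys 4 N) (tgeometry 4 N) id (fun _ => le_rfl) bondsOf hα₆ (by rw [hκ₀]; exact hκ)
    (by rw [hK₀, hc]; exact h229) hs0 hs1 ht hb₀ hRkp (by rw [hc]; exact hRR) (fun Z W hW Df hDf => link_torus 4 N Z W hW Df hDf)
    hadm Z

variable {C : Carriers} {P : MeasPotFrame C} {Op : Type*} [NormedAddCommGroup Op] [NormedSpace ℂ Op]
  {𝒴 : ℕ → InnerLabel (TDom 4 N) Bnd → Type*} {dom : ∀ k i, 𝒴 k i → C.Dom}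
  {β : ℕ → InnerLabel (TDom 4 N) Bnd → Type*} [∀ k i, MeasurableSpace (β k i)]
  {α : ℕ → InnerLabel (TDom 4 N) Bnd → Type*} [∀ k i, NormedAddCommGroup (α k i)]
  [∀ k i, InnerProductSpace ℝ (α k i)] [∀ k i, FiniteDimensional ℝ (α k i)] [∀ k i, MeasurableSpace (α k i)]
  [∀ k i, BorelSpace (α k i)]

open Classical in
/-- **N0y's ATTACHED-PART END AT NE5's INDEX ON THE TORUS — NO LINK BINDER, NO GEOMETRY HYPOTHESIS, NO `hmono`** (kernel; N0y §2
`attachedPart_locE_le_of_coresAt_pencil_recordLabels` ONCE BY NAME at `D = Dk := tsys 4 N`, `G = Gk := tgeometry 4 N`, `foot := id`,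
`hlink := link_torus 4 N`, `b₅ := 5·r₁`, letters located): one core per record label `⟨Z₀, fam, P⟩` of each torus polymer (`hadm`: `Z₀ = Z`,
`fam` inside `Z₀`, print's finer constraints on `P`), the per-label AMPLITUDE `hAmp`, the bond letter `hb₀`, the located clauses and the
rate bookkeeping `Rkp ≤ R − 64·(e^{5R}·s·e^{b₀t})`, N0m's `hϱ`∕`hϱA`: the attached part is
`≤ 4·(e·9·64·K₀(64,8)²)·A₁·e^{−r₁·torusTreeLen X₀}`. [folklore] -/
theorem attachedPart_locE_le_of_coresAt_pencil_recordLabels_torus {Win : Set (ℕ → ℝ)}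
    {ctr : ℕ → (ℕ → ℝ) → C.BgB → Op × B13HistM P} {ROp RHist R' : ℕ → ℝ}
    (𝔊 : ∀ k i, C.Dom → BiCore P (dom k i) Op (β k i) (α k i)) {mq bq N₀ : ℕ → InnerLabel (TDom 4 N) Bnd → C.Dom → ℝ}
    (hroom : ∀ k, ROp k < R' k)
    (hm : ∀ k, ∀ g ∈ Win, ∀ (U : C.BgB) (X : C.Dom), C.scale X = k → ∀ i, 0 < mq k i X)
    (hN : ∀ k, ∀ g ∈ Win, ∀ (U : C.BgB) (X : C.Dom), C.scale X = k → ∀ i,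
      (∀ o ∈ ball (ctr k g U).1 (R' k), AEStronglyMeasurable ((𝔊 k i X).N o) (𝔊 k i X).lam) ∧
      (∀ p, DifferentiableOn ℂ (fun o => (𝔊 k i X).N o p) (ball (ctr k g U).1 (R' k))) ∧
      (∀ o ∈ ball (ctr k g U).1 (R' k), ∀ p, ‖(𝔊 k i X).N o p‖ ≤ N₀ k i X))
    (hq : ∀ k, ∀ g ∈ Win, ∀ (U : C.BgB) (X : C.Dom), C.scale X = k → ∀ i,
      (∀ o ∈ ball (ctr k g U).1 (R' k),
        AEStronglyMeasurable (Function.uncurry ((𝔊 k i X).q o)) ((𝔊 k i X).lam.prod volume)) ∧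
      (∀ p v, DifferentiableOn ℂ (fun o => (𝔊 k i X).q o p v) (ball (ctr k g U).1 (R' k))) ∧
      (∀ o ∈ ball (ctr k g U).1 (R' k), ∀ p v, mq k i X * ‖v‖ ^ 2 - bq k i X ≤ ((𝔊 k i X).q o p v).re))
    {k : ℕ} {g : ℕ → ℝ} (hg : g ∈ Win) {U : C.BgB} {o : Op} {h₀ w : B13HistM P} {ϱ : ℝ}
    (hO : ‖o - (ctr k g U).1‖ ≤ ROp k) (hH : ‖h₀ - (ctr k g U).2‖ + ϱ * ‖w‖ ≤ RHist k)
    {emb : (tsys 4 N).Dom → C.Dom} (hscale : ∀ Z, C.scale (emb Z) = k)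
    {terms : (tsys 4 N).Dom → Finset (InnerLabel (TDom 4 N) Bnd)} {act : ℂ → (tsys 4 N).Dom → ℂ}
    (hact : ∀ σ ∈ ball (0 : ℂ) ϱ, ∀ Z, act σ Z = ∑ i ∈ terms Z, (𝔊 k i (emb Z)).termAt o (h₀ + σ • w))
    {A₀ A₁ Rkp r₁ : ℝ} (X₀ : (tsys 4 N).Dom) (hA₀ : 0 ≤ A₀) (hA₁ : 0 ≤ A₁) (hr₁ : 0 ≤ r₁)
    (hrate : r₁ + 2 * (64 * Real.log 162) + 2 ≤ Rkp)
    (hsmall : (A₀ + ϱ * A₁) * Real.exp (5 * r₁ + 1) * K₀ 64 8 * 9 * 64 ≤ 1)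
    (bondsOf : Finset (TPt 4 N) → Finset Bnd) {δ κ α₆ R b₀ s t : ℝ} (hα₆ : 0 ≤ α₆)
    (hκ : 64 * Real.log 162 + 1 ≤ δ * κ) (h229 : Real.exp 1 * K₀ 64 8 * 64 * α₆ ≤ 1)
    (hs0 : 0 ≤ s) (hs1 : s ≤ 1) (ht : 0 ≤ t) (hb₀ : ∀ W, ((bondsOf W).card : ℝ) ≤ b₀ * W.card)
    (hRR : Rkp ≤ R - 64 * (Real.exp (R * 5) * s * Real.exp (b₀ * t)))
    (hadm : ∀ Z : (tsys 4 N).Dom, ∀ ℓ ∈ terms Z, ℓ.Z₀ = Z ∧ (∀ Y ∈ ℓ.fam, Y.1 ⊆ ℓ.Z₀.1) ∧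
      ℓ.P ⊆ bondsOf (ℓ.Z₀.1 \ ℓ.fam.biUnion fun Y : (tsys 4 N).Dom => Y.1) ∧
        (ℓ.Z₀.1 \ ℓ.fam.biUnion fun Y : (tsys 4 N).Dom => Y.1).card ≤ 2 * ℓ.P.card)
    (hAmp : ∀ Z : (tsys 4 N).Dom, Z.1 ⊆ X₀.1 → ∀ ℓ ∈ terms Z,
      (𝔊 k ℓ (emb Z)).lam.real univ * ((𝔊 k ℓ (emb Z)).wB * N₀ k ℓ (emb Z) * Real.exp (bq k ℓ (emb Z))) *
          (Real.pi / (mq k ℓ (emb Z) / 2)) ^ (Module.finrank ℝ (α k ℓ) / 2 : ℝ) *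
        Real.exp ((𝔊 k ℓ (emb Z)).N₁ * (‖h₀‖ + ϱ * ‖w‖)) ≤
      (A₀ + ϱ * A₁) * ((∏ Y ∈ ℓ.fam, (α₆ * Real.exp (-(δ * κ * torusTreeLen Y.1)) *
        Real.exp (-(R * (torusTreeLen Y.1 + 5))))) * (s ^ 2 * t) ^ ℓ.P.card))
    (hϱ : 2 ≤ ϱ) (hϱA : A₀ ≤ ϱ * A₁) :
    ‖locE (TTouch (d := 4) (N := N)) (fun Z : (tsys 4 N).Dom => Z.1) (act 1) X₀.1 -
        locE (TTouch (d := 4) (N := N)) (fun Z : (tsys 4 N).Dom => Z.1) (act 0) X₀.1‖ ≤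
      4 * (Real.exp 1 * 9 * 64 * K₀ 64 8 ^ 2) * A₁ * Real.exp (-(r₁ * torusTreeLen X₀.1)) := by
  obtain ⟨hν, hκ₀, hc⟩ := torus_consts N
  have hK₀ := K₀_four (N := N)
  have h := attachedPart_locE_le_of_coresAt_pencil_recordLabels (tsys 4 N) (tgeometry 4 N) (tgeometry 4 N) 𝔊 hroom hm hN hq hg
    hO hH hscale hact (Rkp := Rkp) (b₅ := 5 * r₁) (X₀ := X₀) hA₀ hA₁ hr₁ (le_of_eq (by ring)) (by rw [hκ₀]; exact hrate)
    (by rw [hK₀, hν, hc]; exact hsmall) id (fun _ => le_rfl) bondsOf hα₆ (by rw [hκ₀]; exact hκ) (by rw [hK₀, hc]; exact h229)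
    hs0 hs1 ht hb₀ (by rw [hc]; exact hRR) (fun Z W hW Df hDf => link_torus 4 N Z W hW Df hDf) hadm hAmp hϱ hϱA
  rw [hν, hc, hK₀] at h
  exact h

open Classical in
/-- **N0y's μ-PART END (SOURCE PENCIL `h₀ + s • v`, `‖s‖ < μ₁`) AT NE5's INDEX ON THE TORUS — NO LINK BINDER, NO GEOMETRY HYPOTHESIS,
NO `hmono`** (kernel; N0y §2 `muPart_locE_le_of_coresAt_pencil_recordLabels` ONCE BY NAME at `D = Dk := tsys 4 N`, `G = Gk :=
tgeometry 4 N`, `foot := id`, `hlink := link_torus 4 N`, `b₅ := 5·r₁`, letters located): for `0 < μ₀ < μ₁`, `‖sμ‖ ≤ μ₀`,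
`‖E[act sμ](X₀) − E[act 0](X₀)‖ ≤ e·9·64·K₀(64,8)²·A·e^{−r₁·torusTreeLen X₀}·μ₀∕(μ₁ − μ₀)`. [folklore] -/
theorem muPart_locE_le_of_coresAt_pencil_recordLabels_torus {Win : Set (ℕ → ℝ)}
    {ctr : ℕ → (ℕ → ℝ) → C.BgB → Op × B13HistM P} {ROp RHist R' : ℕ → ℝ}
    (𝔊 : ∀ k i, C.Dom → BiCore P (dom k i) Op (β k i) (α k i)) {mq bq N₀ : ℕ → InnerLabel (TDom 4 N) Bnd → C.Dom → ℝ}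
    (hroom : ∀ k, ROp k < R' k)
    (hm : ∀ k, ∀ g ∈ Win, ∀ (U : C.BgB) (X : C.Dom), C.scale X = k → ∀ i, 0 < mq k i X)
    (hN : ∀ k, ∀ g ∈ Win, ∀ (U : C.BgB) (X : C.Dom), C.scale X = k → ∀ i,
      (∀ o ∈ ball (ctr k g U).1 (R' k), AEStronglyMeasurable ((𝔊 k i X).N o) (𝔊 k i X).lam) ∧
      (∀ p, DifferentiableOn ℂ (fun o => (𝔊 k i X).N o p) (ball (ctr k g U).1 (R' k))) ∧
      (∀ o ∈ ball (ctr k g U).1 (R' k), ∀ p, ‖(𝔊 k i X).N o p‖ ≤ N₀ k i X))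
    (hq : ∀ k, ∀ g ∈ Win, ∀ (U : C.BgB) (X : C.Dom), C.scale X = k → ∀ i,
      (∀ o ∈ ball (ctr k g U).1 (R' k),
        AEStronglyMeasurable (Function.uncurry ((𝔊 k i X).q o)) ((𝔊 k i X).lam.prod volume)) ∧
      (∀ p v, DifferentiableOn ℂ (fun o => (𝔊 k i X).q o p v) (ball (ctr k g U).1 (R' k))) ∧
      (∀ o ∈ ball (ctr k g U).1 (R' k), ∀ p v, mq k i X * ‖v‖ ^ 2 - bq k i X ≤ ((𝔊 k i X).q o p v).re))
    {k : ℕ} {g : ℕ → ℝ} (hg : g ∈ Win) {U : C.BgB} {o : Op} {h₀ v : B13HistM P} {μ₁ : ℝ}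
    (hO : ‖o - (ctr k g U).1‖ ≤ ROp k) (hH : ‖h₀ - (ctr k g U).2‖ + μ₁ * ‖v‖ ≤ RHist k)
    {emb : (tsys 4 N).Dom → C.Dom} (hscale : ∀ Z, C.scale (emb Z) = k)
    {terms : (tsys 4 N).Dom → Finset (InnerLabel (TDom 4 N) Bnd)} {act : ℂ → (tsys 4 N).Dom → ℂ}
    (hact : ∀ σ ∈ ball (0 : ℂ) μ₁, ∀ Z, act σ Z = ∑ i ∈ terms Z, (𝔊 k i (emb Z)).termAt o (h₀ + σ • v))
    {A Rkp r₁ μ₀ : ℝ} (X₀ : (tsys 4 N).Dom) {sμ : ℂ} (hA : 0 ≤ A) (hr₁ : 0 ≤ r₁)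
    (hrate : r₁ + 2 * (64 * Real.log 162) + 2 ≤ Rkp) (hsmall : A * Real.exp (5 * r₁ + 1) * K₀ 64 8 * 9 * 64 ≤ 1)
    (bondsOf : Finset (TPt 4 N) → Finset Bnd) {δ κ α₆ R b₀ s t : ℝ} (hα₆ : 0 ≤ α₆)
    (hκ : 64 * Real.log 162 + 1 ≤ δ * κ) (h229 : Real.exp 1 * K₀ 64 8 * 64 * α₆ ≤ 1)
    (hs0 : 0 ≤ s) (hs1 : s ≤ 1) (ht : 0 ≤ t) (hb₀ : ∀ W, ((bondsOf W).card : ℝ) ≤ b₀ * W.card)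
    (hRR : Rkp ≤ R - 64 * (Real.exp (R * 5) * s * Real.exp (b₀ * t)))
    (hadm : ∀ Z : (tsys 4 N).Dom, ∀ ℓ ∈ terms Z, ℓ.Z₀ = Z ∧ (∀ Y ∈ ℓ.fam, Y.1 ⊆ ℓ.Z₀.1) ∧
      ℓ.P ⊆ bondsOf (ℓ.Z₀.1 \ ℓ.fam.biUnion fun Y : (tsys 4 N).Dom => Y.1) ∧
        (ℓ.Z₀.1 \ ℓ.fam.biUnion fun Y : (tsys 4 N).Dom => Y.1).card ≤ 2 * ℓ.P.card)
    (hAmp : ∀ Z : (tsys 4 N).Dom, Z.1 ⊆ X₀.1 → ∀ ℓ ∈ terms Z,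
      (𝔊 k ℓ (emb Z)).lam.real univ * ((𝔊 k ℓ (emb Z)).wB * N₀ k ℓ (emb Z) * Real.exp (bq k ℓ (emb Z))) *
          (Real.pi / (mq k ℓ (emb Z) / 2)) ^ (Module.finrank ℝ (α k ℓ) / 2 : ℝ) *
        Real.exp ((𝔊 k ℓ (emb Z)).N₁ * (‖h₀‖ + μ₁ * ‖v‖)) ≤
      A * ((∏ Y ∈ ℓ.fam, (α₆ * Real.exp (-(δ * κ * torusTreeLen Y.1)) *
        Real.exp (-(R * (torusTreeLen Y.1 + 5))))) * (s ^ 2 * t) ^ ℓ.P.card))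
    (h0 : 0 < μ₀) (h01 : μ₀ < μ₁) (hμ : ‖sμ‖ ≤ μ₀) :
    ‖locE (TTouch (d := 4) (N := N)) (fun Z : (tsys 4 N).Dom => Z.1) (act sμ) X₀.1 -
        locE (TTouch (d := 4) (N := N)) (fun Z : (tsys 4 N).Dom => Z.1) (act 0) X₀.1‖ ≤
      Real.exp 1 * 9 * 64 * K₀ 64 8 ^ 2 * A * Real.exp (-(r₁ * torusTreeLen X₀.1)) * (μ₀ / (μ₁ - μ₀)) := by
  obtain ⟨hν, hκ₀, hc⟩ := torus_consts N
  have hK₀ := K₀_four (N := N)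
  have h := muPart_locE_le_of_coresAt_pencil_recordLabels (tsys 4 N) (tgeometry 4 N) (tgeometry 4 N) 𝔊 hroom hm hN hq hg hO hH
    hscale hact (Rkp := Rkp) (b₅ := 5 * r₁) (X₀ := X₀) (sμ := sμ) hA hr₁ (le_of_eq (by ring)) (by rw [hκ₀]; exact hrate)
    (by rw [hK₀, hν, hc]; exact hsmall) id (fun _ => le_rfl) bondsOf hα₆ (by rw [hκ₀]; exact hκ) (by rw [hK₀, hc]; exact h229)
    hs0 hs1 ht hb₀ (by rw [hc]; exact hRR) (fun Z W hW Df hDf => link_torus 4 N Z W hW Df hDf) hadm hAmp h0 h01 hμ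
  rw [hν, hc, hK₀] at h
  exact h

end OneTorus

/-! ## §2 ON THE NESTED TORI `(N, L·N)` (`foot := trefineDom L N`, S43.1; link at the FINE torus, S40.1): count and the two ENDs -/

section NestedTori

variable {N : ℕ} [NeZero N] {L : ℕ} [NeZero L] {Bnd : Type} [DecidableEq Bnd]

open Classical in
/-- **N0y's SECOND-STEP COUNT OVER NE5's LABELS ON THE NESTED TORI — NO FOOTPRINT MAP, NO `hmono`, NO LINK BINDER, NO GEOMETRY
HYPOTHESIS** (kernel; N0y §1 `count_recordLabels_geometry` ONCE BY NAME at `D := tsys 4 N`, `Dk := tsys 4 (L·N)`, `Gk := tgeometry 4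
(L·N)`, `foot := trefineDom L N`, `hmono := torusTreeLen_le_trefine` (S43.1), `hlink := link_torus 4 (L·N)` at the refined footprint
(S40.1), letters located at the fine torus): for record labels `⟨Z₀, fam, P⟩` of a coarse polymer `Z` conditioned at
`Z₀ = trefineDom L N Z`, `fam` (fine domains) inside `Z₀`, print's finer constraints on `P` (`hadm`):
`Σ_{ℓ ∈ terms Z} (Π_{Y∈ℓ.fam} α₆e^{−δκ·d_k Y}e^{−R(d_k Y+5)})·(s²t)^{#ℓ.P} ≤ e^{−Rkp·torusTreeLen Z}` (coarse tree length). [folklore] -/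
theorem count_recordLabels_refined (bondsOf : Finset (TPt 4 (L * N)) → Finset Bnd) {δ κ α₆ R Rkp b₀ s t : ℝ} (hα₆ : 0 ≤ α₆)
    (hκ : 64 * Real.log 162 + 1 ≤ δ * κ) (h229 : Real.exp 1 * K₀ 64 8 * 64 * α₆ ≤ 1) (hs0 : 0 ≤ s) (hs1 : s ≤ 1)
    (ht : 0 ≤ t) (hb₀ : ∀ W, ((bondsOf W).card : ℝ) ≤ b₀ * W.card) (hRkp : 0 ≤ Rkp)
    (hRR : Rkp ≤ R - 64 * (Real.exp (R * 5) * s * Real.exp (b₀ * t)))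
    {terms : (tsys 4 N).Dom → Finset (InnerLabel (TDom 4 (L * N)) Bnd)}
    (hadm : ∀ Z : (tsys 4 N).Dom, ∀ ℓ ∈ terms Z, ℓ.Z₀ = trefineDom L N Z ∧ (∀ Y ∈ ℓ.fam, Y.1 ⊆ ℓ.Z₀.1) ∧
      ℓ.P ⊆ bondsOf (ℓ.Z₀.1 \ ℓ.fam.biUnion fun Y : (tsys 4 (L * N)).Dom => Y.1) ∧
        (ℓ.Z₀.1 \ ℓ.fam.biUnion fun Y : (tsys 4 (L * N)).Dom => Y.1).card ≤ 2 * ℓ.P.card)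
    (Z : (tsys 4 N).Dom) :
    ∑ ℓ ∈ terms Z, (∏ Y ∈ ℓ.fam, (α₆ * Real.exp (-(δ * κ * torusTreeLen Y.1)) *
        Real.exp (-(R * (torusTreeLen Y.1 + 5))))) * (s ^ 2 * t) ^ ℓ.P.card ≤ Real.exp (-(Rkp * torusTreeLen Z.1)) := by
  obtain ⟨-, hκ₀L, hcL⟩ := torus_consts (L * N)
  have hK₀L := K₀_four (N := L * N)
  exact count_recordLabels_geometry (D := tsys 4 N) (tgeometry 4 (L * N)) (trefineDom L N) (fun Z => torusTreeLen_le_trefine Z)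
    bondsOf hα₆ (by rw [hκ₀L]; exact hκ) (by rw [hK₀L, hcL]; exact h229) hs0 hs1 ht hb₀ hRkp (by rw [hcL]; exact hRR)
    (fun Z W hW Df hDf => link_torus 4 (L * N) (trefineDom L N Z) W hW Df hDf) hadm Z

variable {C : Carriers} {P : MeasPotFrame C} {Op : Type*} [NormedAddCommGroup Op] [NormedSpace ℂ Op]
  {𝒴 : ℕ → InnerLabel (TDom 4 (L * N)) Bnd → Type*} {dom : ∀ k i, 𝒴 k i → C.Dom}
  {β : ℕ → InnerLabel (TDom 4 (L * N)) Bnd → Type*} [∀ k i, MeasurableSpace (β k i)]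
  {α : ℕ → InnerLabel (TDom 4 (L * N)) Bnd → Type*} [∀ k i, NormedAddCommGroup (α k i)]
  [∀ k i, InnerProductSpace ℝ (α k i)] [∀ k i, FiniteDimensional ℝ (α k i)] [∀ k i, MeasurableSpace (α k i)]
  [∀ k i, BorelSpace (α k i)]

open Classical in
/-- **N0y's ATTACHED-PART END AT NE5's INDEX ON THE NESTED TORI `(N, L·N)` — NO FOOTPRINT MAP, NO `hmono`, NO LINK BINDER, NO
GEOMETRY HYPOTHESIS** (kernel; N0y §2 `attachedPart_locE_le_of_coresAt_pencil_recordLabels` ONCE BY NAME at `D := tsys 4 N`,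
`G := tgeometry 4 N`, `Dk := tsys 4 (L·N)`, `Gk := tgeometry 4 (L·N)`, `foot := trefineDom L N`, `hmono := torusTreeLen_le_trefine`
(S43.1), `hlink := link_torus 4 (L·N)` (S40.1), `b₅ := 5·r₁`, letters located at BOTH scales): one core per record label `⟨Z₀, fam, P⟩`
of each coarse polymer `Z`, conditioned at the REFINED footprint `Z₀ = trefineDom L N Z` with `fam` a family of FINE-torus localization
domains inside it and print's finer constraints on `P` (`hadm`), the per-label AMPLITUDE `hAmp` (decay in the FINE tree lengths), the bond
letter `hb₀`, the located clauses and the rate bookkeeping `Rkp ≤ R − 64·(e^{5R}·s·e^{b₀t})`, N0m's `hϱ`∕`hϱA`: the attached part at the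
COARSE torus is `≤ 4·(e·9·64·K₀(64,8)²)·A₁·e^{−r₁·torusTreeLen X₀}`. [folklore] -/
theorem attachedPart_locE_le_of_coresAt_pencil_recordLabels_refined {Win : Set (ℕ → ℝ)}
    {ctr : ℕ → (ℕ → ℝ) → C.BgB → Op × B13HistM P} {ROp RHist R' : ℕ → ℝ}
    (𝔊 : ∀ k i, C.Dom → BiCore P (dom k i) Op (β k i) (α k i)) {mq bq N₀ : ℕ → InnerLabel (TDom 4 (L * N)) Bnd → C.Dom → ℝ}
    (hroom : ∀ k, ROp k < R' k)
    (hm : ∀ k, ∀ g ∈ Win, ∀ (U : C.BgB) (X : C.Dom), C.scale X = k → ∀ i, 0 < mq k i X)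
    (hN : ∀ k, ∀ g ∈ Win, ∀ (U : C.BgB) (X : C.Dom), C.scale X = k → ∀ i,
      (∀ o ∈ ball (ctr k g U).1 (R' k), AEStronglyMeasurable ((𝔊 k i X).N o) (𝔊 k i X).lam) ∧
      (∀ p, DifferentiableOn ℂ (fun o => (𝔊 k i X).N o p) (ball (ctr k g U).1 (R' k))) ∧
      (∀ o ∈ ball (ctr k g U).1 (R' k), ∀ p, ‖(𝔊 k i X).N o p‖ ≤ N₀ k i X))
    (hq : ∀ k, ∀ g ∈ Win, ∀ (U : C.BgB) (X : C.Dom), C.scale X = k → ∀ i,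
      (∀ o ∈ ball (ctr k g U).1 (R' k),
        AEStronglyMeasurable (Function.uncurry ((𝔊 k i X).q o)) ((𝔊 k i X).lam.prod volume)) ∧
      (∀ p v, DifferentiableOn ℂ (fun o => (𝔊 k i X).q o p v) (ball (ctr k g U).1 (R' k))) ∧
      (∀ o ∈ ball (ctr k g U).1 (R' k), ∀ p v, mq k i X * ‖v‖ ^ 2 - bq k i X ≤ ((𝔊 k i X).q o p v).re))
    {k : ℕ} {g : ℕ → ℝ} (hg : g ∈ Win) {U : C.BgB} {o : Op} {h₀ w : B13HistM P} {ϱ : ℝ}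
    (hO : ‖o - (ctr k g U).1‖ ≤ ROp k) (hH : ‖h₀ - (ctr k g U).2‖ + ϱ * ‖w‖ ≤ RHist k)
    {emb : (tsys 4 N).Dom → C.Dom} (hscale : ∀ Z, C.scale (emb Z) = k)
    {terms : (tsys 4 N).Dom → Finset (InnerLabel (TDom 4 (L * N)) Bnd)} {act : ℂ → (tsys 4 N).Dom → ℂ}
    (hact : ∀ σ ∈ ball (0 : ℂ) ϱ, ∀ Z, act σ Z = ∑ i ∈ terms Z, (𝔊 k i (emb Z)).termAt o (h₀ + σ • w))
    {A₀ A₁ Rkp r₁ : ℝ} (X₀ : (tsys 4 N).Dom) (hA₀ : 0 ≤ A₀) (hA₁ : 0 ≤ A₁) (hr₁ : 0 ≤ r₁)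
    (hrate : r₁ + 2 * (64 * Real.log 162) + 2 ≤ Rkp)
    (hsmall : (A₀ + ϱ * A₁) * Real.exp (5 * r₁ + 1) * K₀ 64 8 * 9 * 64 ≤ 1)
    (bondsOf : Finset (TPt 4 (L * N)) → Finset Bnd) {δ κ α₆ R b₀ s t : ℝ} (hα₆ : 0 ≤ α₆)
    (hκ : 64 * Real.log 162 + 1 ≤ δ * κ) (h229 : Real.exp 1 * K₀ 64 8 * 64 * α₆ ≤ 1)
    (hs0 : 0 ≤ s) (hs1 : s ≤ 1) (ht : 0 ≤ t) (hb₀ : ∀ W, ((bondsOf W).card : ℝ) ≤ b₀ * W.card)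
    (hRR : Rkp ≤ R - 64 * (Real.exp (R * 5) * s * Real.exp (b₀ * t)))
    (hadm : ∀ Z : (tsys 4 N).Dom, ∀ ℓ ∈ terms Z, ℓ.Z₀ = trefineDom L N Z ∧ (∀ Y ∈ ℓ.fam, Y.1 ⊆ ℓ.Z₀.1) ∧
      ℓ.P ⊆ bondsOf (ℓ.Z₀.1 \ ℓ.fam.biUnion fun Y : (tsys 4 (L * N)).Dom => Y.1) ∧
        (ℓ.Z₀.1 \ ℓ.fam.biUnion fun Y : (tsys 4 (L * N)).Dom => Y.1).card ≤ 2 * ℓ.P.card)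
    (hAmp : ∀ Z : (tsys 4 N).Dom, Z.1 ⊆ X₀.1 → ∀ ℓ ∈ terms Z,
      (𝔊 k ℓ (emb Z)).lam.real univ * ((𝔊 k ℓ (emb Z)).wB * N₀ k ℓ (emb Z) * Real.exp (bq k ℓ (emb Z))) *
          (Real.pi / (mq k ℓ (emb Z) / 2)) ^ (Module.finrank ℝ (α k ℓ) / 2 : ℝ) *
        Real.exp ((𝔊 k ℓ (emb Z)).N₁ * (‖h₀‖ + ϱ * ‖w‖)) ≤
      (A₀ + ϱ * A₁) * ((∏ Y ∈ ℓ.fam, (α₆ * Real.exp (-(δ * κ * torusTreeLen Y.1)) *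
        Real.exp (-(R * (torusTreeLen Y.1 + 5))))) * (s ^ 2 * t) ^ ℓ.P.card))
    (hϱ : 2 ≤ ϱ) (hϱA : A₀ ≤ ϱ * A₁) :
    ‖locE (TTouch (d := 4) (N := N)) (fun Z : (tsys 4 N).Dom => Z.1) (act 1) X₀.1 -
        locE (TTouch (d := 4) (N := N)) (fun Z : (tsys 4 N).Dom => Z.1) (act 0) X₀.1‖ ≤
      4 * (Real.exp 1 * 9 * 64 * K₀ 64 8 ^ 2) * A₁ * Real.exp (-(r₁ * torusTreeLen X₀.1)) := by
  obtain ⟨hν, hκ₀, hc⟩ := torus_consts N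
  obtain ⟨-, hκ₀L, hcL⟩ := torus_consts (L * N)
  have hK₀ := K₀_four (N := N)
  have hK₀L := K₀_four (N := L * N)
  have h := attachedPart_locE_le_of_coresAt_pencil_recordLabels (tsys 4 N) (tgeometry 4 N) (tgeometry 4 (L * N)) 𝔊 hroom hm hN
    hq hg hO hH hscale hact (Rkp := Rkp) (b₅ := 5 * r₁) (X₀ := X₀) hA₀ hA₁ hr₁ (le_of_eq (by ring)) (by rw [hκ₀]; exact hrate)
    (by rw [hK₀, hν, hc]; exact hsmall) (trefineDom L N) (fun Z => torusTreeLen_le_trefine Z) bondsOf hα₆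
    (by rw [hκ₀L]; exact hκ) (by rw [hK₀L, hcL]; exact h229) hs0 hs1 ht hb₀ (by rw [hcL]; exact hRR)
    (fun Z W hW Df hDf => link_torus 4 (L * N) (trefineDom L N Z) W hW Df hDf) hadm hAmp hϱ hϱA
  rw [hν, hc, hK₀] at h
  exact h

open Classical in
/-- **N0y's μ-PART END (SOURCE PENCIL `h₀ + s • v`, `‖s‖ < μ₁`) AT NE5's INDEX ON THE NESTED TORI `(N, L·N)` — NO FOOTPRINT MAP, NO
`hmono`, NO LINK BINDER, NO GEOMETRY HYPOTHESIS** (kernel; N0y §2 `muPart_locE_le_of_coresAt_pencil_recordLabels` ONCE BY NAME at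
`D := tsys 4 N`, `G := tgeometry 4 N`, `Dk := tsys 4 (L·N)`, `Gk := tgeometry 4 (L·N)`, `foot := trefineDom L N`, `hmono :=
torusTreeLen_le_trefine`, `hlink := link_torus 4 (L·N)`, `b₅ := 5·r₁`, letters located at both scales): for `0 < μ₀ < μ₁`, `‖sμ‖ ≤ μ₀`,
`‖E[act sμ](X₀) − E[act 0](X₀)‖ ≤ e·9·64·K₀(64,8)²·A·e^{−r₁·torusTreeLen X₀}·μ₀∕(μ₁ − μ₀)` at the COARSE torus. [folklore] -/
theorem muPart_locE_le_of_coresAt_pencil_recordLabels_refined {Win : Set (ℕ → ℝ)}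
    {ctr : ℕ → (ℕ → ℝ) → C.BgB → Op × B13HistM P} {ROp RHist R' : ℕ → ℝ}
    (𝔊 : ∀ k i, C.Dom → BiCore P (dom k i) Op (β k i) (α k i)) {mq bq N₀ : ℕ → InnerLabel (TDom 4 (L * N)) Bnd → C.Dom → ℝ}
    (hroom : ∀ k, ROp k < R' k)
    (hm : ∀ k, ∀ g ∈ Win, ∀ (U : C.BgB) (X : C.Dom), C.scale X = k → ∀ i, 0 < mq k i X)
    (hN : ∀ k, ∀ g ∈ Win, ∀ (U : C.BgB) (X : C.Dom), C.scale X = k → ∀ i,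
      (∀ o ∈ ball (ctr k g U).1 (R' k), AEStronglyMeasurable ((𝔊 k i X).N o) (𝔊 k i X).lam) ∧
      (∀ p, DifferentiableOn ℂ (fun o => (𝔊 k i X).N o p) (ball (ctr k g U).1 (R' k))) ∧
      (∀ o ∈ ball (ctr k g U).1 (R' k), ∀ p, ‖(𝔊 k i X).N o p‖ ≤ N₀ k i X))
    (hq : ∀ k, ∀ g ∈ Win, ∀ (U : C.BgB) (X : C.Dom), C.scale X = k → ∀ i,
      (∀ o ∈ ball (ctr k g U).1 (R' k),
        AEStronglyMeasurable (Function.uncurry ((𝔊 k i X).q o)) ((𝔊 k i X).lam.prod volume)) ∧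
      (∀ p v, DifferentiableOn ℂ (fun o => (𝔊 k i X).q o p v) (ball (ctr k g U).1 (R' k))) ∧
      (∀ o ∈ ball (ctr k g U).1 (R' k), ∀ p v, mq k i X * ‖v‖ ^ 2 - bq k i X ≤ ((𝔊 k i X).q o p v).re))
    {k : ℕ} {g : ℕ → ℝ} (hg : g ∈ Win) {U : C.BgB} {o : Op} {h₀ v : B13HistM P} {μ₁ : ℝ}
    (hO : ‖o - (ctr k g U).1‖ ≤ ROp k) (hH : ‖h₀ - (ctr k g U).2‖ + μ₁ * ‖v‖ ≤ RHist k)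
    {emb : (tsys 4 N).Dom → C.Dom} (hscale : ∀ Z, C.scale (emb Z) = k)
    {terms : (tsys 4 N).Dom → Finset (InnerLabel (TDom 4 (L * N)) Bnd)} {act : ℂ → (tsys 4 N).Dom → ℂ}
    (hact : ∀ σ ∈ ball (0 : ℂ) μ₁, ∀ Z, act σ Z = ∑ i ∈ terms Z, (𝔊 k i (emb Z)).termAt o (h₀ + σ • v))
    {A Rkp r₁ μ₀ : ℝ} (X₀ : (tsys 4 N).Dom) {sμ : ℂ} (hA : 0 ≤ A) (hr₁ : 0 ≤ r₁)
    (hrate : r₁ + 2 * (64 * Real.log 162) + 2 ≤ Rkp) (hsmall : A * Real.exp (5 * r₁ + 1) * K₀ 64 8 * 9 * 64 ≤ 1)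
    (bondsOf : Finset (TPt 4 (L * N)) → Finset Bnd) {δ κ α₆ R b₀ s t : ℝ} (hα₆ : 0 ≤ α₆)
    (hκ : 64 * Real.log 162 + 1 ≤ δ * κ) (h229 : Real.exp 1 * K₀ 64 8 * 64 * α₆ ≤ 1)
    (hs0 : 0 ≤ s) (hs1 : s ≤ 1) (ht : 0 ≤ t) (hb₀ : ∀ W, ((bondsOf W).card : ℝ) ≤ b₀ * W.card)
    (hRR : Rkp ≤ R - 64 * (Real.exp (R * 5) * s * Real.exp (b₀ * t)))
    (hadm : ∀ Z : (tsys 4 N).Dom, ∀ ℓ ∈ terms Z, ℓ.Z₀ = trefineDom L N Z ∧ (∀ Y ∈ ℓ.fam, Y.1 ⊆ ℓ.Z₀.1) ∧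
      ℓ.P ⊆ bondsOf (ℓ.Z₀.1 \ ℓ.fam.biUnion fun Y : (tsys 4 (L * N)).Dom => Y.1) ∧
        (ℓ.Z₀.1 \ ℓ.fam.biUnion fun Y : (tsys 4 (L * N)).Dom => Y.1).card ≤ 2 * ℓ.P.card)
    (hAmp : ∀ Z : (tsys 4 N).Dom, Z.1 ⊆ X₀.1 → ∀ ℓ ∈ terms Z,
      (𝔊 k ℓ (emb Z)).lam.real univ * ((𝔊 k ℓ (emb Z)).wB * N₀ k ℓ (emb Z) * Real.exp (bq k ℓ (emb Z))) *
          (Real.pi / (mq k ℓ (emb Z) / 2)) ^ (Module.finrank ℝ (α k ℓ) / 2 : ℝ) *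
        Real.exp ((𝔊 k ℓ (emb Z)).N₁ * (‖h₀‖ + μ₁ * ‖v‖)) ≤
      A * ((∏ Y ∈ ℓ.fam, (α₆ * Real.exp (-(δ * κ * torusTreeLen Y.1)) *
        Real.exp (-(R * (torusTreeLen Y.1 + 5))))) * (s ^ 2 * t) ^ ℓ.P.card))
    (h0 : 0 < μ₀) (h01 : μ₀ < μ₁) (hμ : ‖sμ‖ ≤ μ₀) :
    ‖locE (TTouch (d := 4) (N := N)) (fun Z : (tsys 4 N).Dom => Z.1) (act sμ) X₀.1 -
        locE (TTouch (d := 4) (N := N)) (fun Z : (tsys 4 N).Dom => Z.1) (act 0) X₀.1‖ ≤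
      Real.exp 1 * 9 * 64 * K₀ 64 8 ^ 2 * A * Real.exp (-(r₁ * torusTreeLen X₀.1)) * (μ₀ / (μ₁ - μ₀)) := by
  obtain ⟨hν, hκ₀, hc⟩ := torus_consts N
  obtain ⟨-, hκ₀L, hcL⟩ := torus_consts (L * N)
  have hK₀ := K₀_four (N := N)
  have hK₀L := K₀_four (N := L * N)
  have h := muPart_locE_le_of_coresAt_pencil_recordLabels (tsys 4 N) (tgeometry 4 N) (tgeometry 4 (L * N)) 𝔊 hroom hm hN hq hg
    hO hH hscale hact (Rkp := Rkp) (b₅ := 5 * r₁) (X₀ := X₀) (sμ := sμ) hA hr₁ (le_of_eq (by ring)) (by rw [hκ₀]; exact hrate)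
    (by rw [hK₀, hν, hc]; exact hsmall) (trefineDom L N) (fun Z => torusTreeLen_le_trefine Z) bondsOf hα₆
    (by rw [hκ₀L]; exact hκ) (by rw [hK₀L, hcL]; exact h229) hs0 hs1 ht hb₀ (by rw [hcL]; exact hRR)
    (fun Z W hW Df hDf => link_torus 4 (L * N) (trefineDom L N Z) W hW Df hDf) hadm hAmp h0 h01 hμ
  rw [hν, hc, hK₀] at h
  exact h

end NestedTori

end Summit.QuantumFields.BalabanUV.T4Continuum.NE1p.DressedSmallFieldRecordLabelsTorus

end
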